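import Mathlib
import HarnessLib
import Summits.HodgeConjecture.HodgeConjecture.Theorems.HodgeLocusCensusSymbolicCharts441

/-!
# HodgeLocusCensusSymbolicChartsA441 — the ENGINE-A all-λ charts of the b = 2 census cell (4,4,1) and their identities with the engine-B seat's charts (cell pub-hlocus, LEAD seat ivhs-1, gen 19)
HONEST FRAMING: certified instances and evidence bearing on the general Hodge conjecture; no claim.

SETTING (cell record `data/ivhs/census/og81/ALLLAMBDA-A441-g19.md`; the engine-B seat's record `pub-hlocus-ivhs-2/SYMLAM441-g20.md` and its Lean anchor
`HodgeLocusCensusSymbolicCharts441`).  Same cell (4,4,1) (the standard pair of planes P, P̌ of the Fermat quartic fourfold meeting in a LINE, δ_λ = [P] + λ[P̌]), same complement Λ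
('smart0 c2', 11 slice monomials), same line direction n (79 monomials), same two charts: L2 (= the engine-B seat's chart 1, λ* = 2, free Λ-columns #2,#3,#7) and Li (= its chart 2,
λ* = ι = z², free Λ-columns #2,#3,#6).  The lead's ENGINE-A driver `gen19/kitjobA/symgermA.py` (taylor2 tilted-slice PERIOD kernel; the `analyse()` implicit-function recursion with the
chart's pivot data FORCED; exact arithmetic over ℚ(ζ₈) at 64 integer λ per chart on kit j133860; degree-bounded exact interpolation, every function verified at every further sample)
reconstructs in each chart the 54 non-zero lowest-terms functions [sⁱu^μ]c_β(λ), |μ| + i ≤ 3, of the formal generic fibre of V_λ ∩ (X_s + Λ) along the line, and finds them EQUAL,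
identically in λ, to the engine-B seat's kernel-A functions (54/54 per chart; and = (1/128)·(−1)^{|α|} × its kernel-B functions), with pivot determinants
Δ_A(L2) = (8z³ − 8z)·λ³(λ − 1)(λ − ι)², Δ_A(Li) = (8z + 8z³)·λ³(λ − 1)³ (= 8 × the other seat's content-normalised Δ₁, Δ₂).  Its own μ₀ ≤ 3 certificate is the TROPICAL PERMUTATION
EXPANSION of 7 × 7 minors of the N = 3 Hilbert matrix (rows u^γ·h_β, |γ| ≤ 1; columns u^μ, 1 ≤ |μ| ≤ 2): the s^OPT-coefficient D(λ) ∈ ℚ(ζ₈)(λ) of such a minor is a signed sum of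
products of the reconstructed functions, and wherever Δ_A(λ₀)·D(λ₀) ≠ 0 the Hilbert matrix has rank ≥ 7, so dim R/(I + m³) ≤ 3 and (with the tree's λ-free lower bound e ≥ 2,
`Literature.AlgebraicGeometry.Kloosterman2025.twoPlanes_finrank_inf_add_ciHilbert_le` + `census_cells_bounds` row (4,4,1)) μ₀(4,4,1; λ₀) = 3 by the cell's accepted argument.
The gcd of the numerators of the lead's 8 usable minors is λ³(λ − 1)² in chart L2 and λ³ in chart Li; the engine-B seat's 10 + 10 named minors, recomputed from the lead's functions,
satisfy  (their det polynomial) = D · Δ^S  EXACTLY (S = Σ of their row Δ-powers), 20/20 — in particular its headline minor m₂ = −9ι·λ⁵⁸(λ − 1)⁵⁰ of chart 2 is the lead's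
D = (9ι/512)·λ⁴/(λ − 1)⁴ times Δ₂¹⁸, because (z + z³)¹⁸ = −512.
WHAT THE KERNEL CHECKS HERE (field arithmetic over an arbitrary field K of characteristic 0 with z⁴ = −1; no computation is replayed): the engine-A chart polynomials as literal `def`s;
(1) `deltaA441L2_eq`, `deltaA441Li_eq`: Δ_A = 8·Δ₁, 8·Δ₂ of the other seat's file (same pivot blocks); (2) `headline_minor_identity`: (9ι/512)·λ⁴·Δ₂¹⁸ = m₂·(λ − 1)⁴, via
`z_add_z_cube_pow_eighteen` ((z + z³)¹⁸ = −512); (3) `chartLi_decisive` / `chartL2_decisive`: engine A's chart Li is valid with non-zero minor gcd at every λ ∉ {0, 1}, chart L2 at every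
λ ∉ {0, 1, ι}; `deltaA441Li_eq_zero_iff`, `deltaA441L2_eq_zero_iff`: exactly where each chart fails; `excA441_eq` : both engine-A exceptional polynomials vanish iff λ ∈ {0, 1} — the same
two-point set as the engine-B seat's `exceptional_set_eq`; (4) `hf2_leading_minor_L2`: the leading u-linear layer of chart L2 (rows x4x5, x4²; columns u₁, u₃) has vanishing 2 × 2
minor, as the kernel theorem e ≥ 2 (rank HF₂ ≤ 1) demands of the reconstructed functions.
NOT FORMALISED: the period computation and the interpolation (Python, kit j133860), the permutation-expansion argument, Nakayama/semicontinuity, the passage to μ₀, all Hodge theory.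
Nothing in this file is a statement about the Hodge conjecture.
-/

namespace Summit.HodgeConjecture.HodgeConjecture.HodgeLocus.Census.SymbolicChartsA441

open Summit.HodgeConjecture.HodgeConjecture.HodgeLocus.Census.SymbolicCharts441

variable {K : Type*} [Field K] [CharZero K]

/-! ## The engine-A chart polynomials (literal transcription of `gen19/symA441_L2.json`, `symA441_Li.json`, `certA441_L2.json`, `certA441_Li.json`; z = ζ₈, ι = z²) -/

/-- Δ_A of chart L2 (pivot rows x1x3, x1², x1x5, x1x4, x3², x3x5, x3x4, x5²; pivot Λ-columns 0,1,4,5,6,8,9,10): coefficients λ³…λ⁶ = (8z³−8z, −8z−24z³, 24z+8z³, 8z³−8z). -/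
def deltaA441L2 (z lam : K) : K := (8 * z ^ 3 - 8 * z) * lam ^ 3 * (lam - 1) * (lam - z ^ 2) ^ 2

/-- Δ_A of chart Li (pivot rows x1x3, x1², x1x4, x1x5, x3², x3x4, x3x5, x4x5; pivot Λ-columns 0,1,4,5,7,8,9,10). -/
def deltaA441Li (z lam : K) : K := (8 * z + 8 * z ^ 3) * lam ^ 3 * (lam - 1) ^ 3

/-- gcd (up to a unit) of the numerators of the lead's 8 usable 7×7 tropical minors D(λ) in chart L2. -/
def gcdA441L2 (lam : K) : K := lam ^ 3 * (lam - 1) ^ 2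

/-- gcd (up to a unit) of the numerators of the lead's 8 usable 7×7 tropical minors D(λ) in chart Li. -/
def gcdA441Li (lam : K) : K := lam ^ 3

/-- engine A's exceptional polynomial of chart L2. -/
def excA441L2 (z lam : K) : K := deltaA441L2 z lam * gcdA441L2 lam

/-- engine A's exceptional polynomial of chart Li. -/
def excA441Li (z lam : K) : K := deltaA441Li z lam * gcdA441Li lam

/-- numerator of the lead's permutation-expansion coefficient D(λ) = (9ι/512)·λ⁴/(λ−1)⁴ for the engine-B seat's named minor no. 3 of chart Li
(rows u⁰c_{x4²}, u⁰c_{x2²}, u₃c_{x5²}, u₁c_{x4²}, u₂c_{x5²}, u⁰c_{x0x2}, u⁰c_{x5²}; columns u₂u₃, u₁u₂, u₁u₃, u₃², u₁², u₂², u₃; OPT = 6). -/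
def dnumA441Li3 (z lam : K) : K := 9 / 512 * z ^ 2 * lam ^ 4

/-- its denominator (λ − 1)⁴. -/
def ddenA441Li3 (lam : K) : K := (lam - 1) ^ 4

/-! ## (1) Same pivot blocks as the engine-B seat: Δ_A = 8·Δ (its files store Δ with the integer content 8 removed) -/

omit [CharZero K] in
/-- Δ_A(L2) = 8·Δ₁ of the engine-B seat (same 8×8 pivot block; its file removes the integer content 8). -/
theorem deltaA441L2_eq (z lam : K) : deltaA441L2 z lam = 8 * delta441c1 z lam := by
  unfold deltaA441L2 delta441c1; ring

omit [CharZero K] in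
/-- Δ_A(Li) = 8·Δ₂ of the engine-B seat. -/
theorem deltaA441Li_eq (z lam : K) : deltaA441Li z lam = 8 * delta441c2 z lam := by
  unfold deltaA441Li delta441c2; ring

omit [CharZero K] in
/-- the literal λ-coefficients of Δ_A(L2) as interpolated from the samples. -/
theorem deltaA441L2_coeffs (z lam : K) (hz : z ^ 4 = -1) :
    deltaA441L2 z lam = (8 * z ^ 3 - 8 * z) * lam ^ 6 + (24 * z + 8 * z ^ 3) * lam ^ 5 + (-8 * z - 24 * z ^ 3) * lam ^ 4 + (8 * z ^ 3 - 8 * z) * lam ^ 3 := by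
  unfold deltaA441L2
  linear_combination (-16 * z * lam ^ 5 + (8 * z ^ 3 + 8 * z) * lam ^ 4 + (8 * z - 8 * z ^ 3) * lam ^ 3) * hz

/-! ## (2) The headline minor of the other seat from the lead's D: (z + z³)¹⁸ = −512 -/

omit [CharZero K] in
/-- (z + z³)² = −2 for z⁴ = −1. -/
theorem z_add_z_cube_sq (z : K) (hz : z ^ 4 = -1) : (z + z ^ 3) ^ 2 = -2 := by
  linear_combination (z ^ 2 + 2) * hz

omit [CharZero K] in
/-- (z + z³)¹⁸ = (−2)⁹ = −512 for z⁴ = −1 (the constant relating the lead's D to the other seat's headline minor). -/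
theorem z_add_z_cube_pow_eighteen (z : K) (hz : z ^ 4 = -1) : (z + z ^ 3) ^ 18 = -512 := by
  rw [show (18 : ℕ) = 2 * 9 from rfl, pow_mul, z_add_z_cube_sq z hz]; norm_num

/-- EXACT cross-seat identity for the headline minor (characteristic 0 is used: 512 is inverted): D · Δ₂¹⁸ = m₂ · (denominator of D), i.e. (9ι/512)·λ⁴·((z+z³)λ³(λ−1)³)¹⁸ = −9ι·λ⁵⁸(λ−1)⁵⁰·(λ−1)⁴. -/
theorem headline_minor_identity (z lam : K) (hz : z ^ 4 = -1) :
    dnumA441Li3 z lam * delta441c2 z lam ^ 18 = minor441c2 z lam * ddenA441Li3 lam := by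
  have h18 := z_add_z_cube_pow_eighteen z hz
  unfold dnumA441Li3 delta441c2 minor441c2 ddenA441Li3
  -- treat m = λ − 1 as an atom so that no binomial power is expanded
  generalize lam - 1 = m
  rw [mul_pow, mul_pow, h18]
  ring

/-! ## (3) Where the engine-A charts are valid and decisive -/

/-- engine A's chart Li fails exactly at λ ∈ {0, 1}. -/
theorem deltaA441Li_eq_zero_iff {z lam : K} (hz : z ^ 4 = -1) : deltaA441Li z lam = 0 ↔ (lam = 0 ∨ lam = 1) := by
  unfold deltaA441Li
  have hu : (8 : K) * z + 8 * z ^ 3 ≠ 0 := by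
    have : (8 : K) * z + 8 * z ^ 3 = 8 * (z + z ^ 3) := by ring
    rw [this]; exact mul_ne_zero (by norm_num) (z_add_z_cube_ne_zero hz)
  constructor
  · intro h
    rcases mul_eq_zero.mp h with h | h
    · rcases mul_eq_zero.mp h with h | h
      · exact absurd h hu
      · exact Or.inl (pow_eq_zero_iff (by norm_num) |>.mp h)
    · exact Or.inr (sub_eq_zero.mp (pow_eq_zero_iff (by norm_num) |>.mp h))
  · rintro (rfl | rfl) <;> simp

/-- engine A's chart L2 fails exactly at λ ∈ {0, 1, ι}. -/
theorem deltaA441L2_eq_zero_iff {z lam : K} (hz : z ^ 4 = -1) : deltaA441L2 z lam = 0 ↔ (lam = 0 ∨ lam = 1 ∨ lam = z ^ 2) := by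
  unfold deltaA441L2
  have hu : (8 : K) * z ^ 3 - 8 * z ≠ 0 := by
    have : (8 : K) * z ^ 3 - 8 * z = 8 * (z ^ 3 - z) := by ring
    rw [this]; exact mul_ne_zero (by norm_num) (z_cube_sub_z_ne_zero hz)
  constructor
  · intro h
    rcases mul_eq_zero.mp h with h | h
    · rcases mul_eq_zero.mp h with h | h
      · rcases mul_eq_zero.mp h with h | h
        · exact absurd h hu
        · exact Or.inl (pow_eq_zero_iff (by norm_num) |>.mp h)
      · exact Or.inr (Or.inl (sub_eq_zero.mp h))
    · exact Or.inr (Or.inr (sub_eq_zero.mp (pow_eq_zero_iff (by norm_num) |>.mp h)))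
  · rintro (rfl | rfl | rfl) <;> simp

/-- engine A's chart Li ALONE covers: at every λ ∉ {0, 1} it is valid and the gcd of its minor numerators is non-zero. -/
theorem chartLi_decisive {z lam : K} (hz : z ^ 4 = -1) (h0 : lam ≠ 0) (h1 : lam ≠ 1) : excA441Li z lam ≠ 0 := by
  unfold excA441Li gcdA441Li
  refine mul_ne_zero ?_ (pow_ne_zero 3 h0)
  intro h
  rcases (deltaA441Li_eq_zero_iff hz).mp h with h | h
  · exact h0 h
  · exact h1 h

/-- engine A's chart L2 is valid and decisive at every λ ∉ {0, 1, ι}. -/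
theorem chartL2_decisive {z lam : K} (hz : z ^ 4 = -1) (h0 : lam ≠ 0) (h1 : lam ≠ 1) (hi : lam ≠ z ^ 2) : excA441L2 z lam ≠ 0 := by
  unfold excA441L2 gcdA441L2
  refine mul_ne_zero ?_ (mul_ne_zero (pow_ne_zero 3 h0) (pow_ne_zero 2 (sub_ne_zero.mpr h1)))
  intro h
  rcases (deltaA441L2_eq_zero_iff hz).mp h with h | h | h
  · exact h0 h
  · exact h1 h
  · exact hi h

/-- both engine-A exceptional polynomials vanish iff λ ∈ {0, 1}: the same two-point exceptional set as the engine-B seat's three charts (`SymbolicCharts441.exceptional_set_eq`). -/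
theorem excA441_eq {z lam : K} (hz : z ^ 4 = -1) :
    (excA441L2 z lam = 0 ∧ excA441Li z lam = 0) ↔ (lam = 0 ∨ lam = 1) := by
  constructor
  · rintro ⟨-, h⟩
    by_contra hc
    push Not at hc
    exact chartLi_decisive hz hc.1 hc.2 h
  · rintro (rfl | rfl)
    · simp [excA441L2, excA441Li, gcdA441L2, gcdA441Li]
    · simp [excA441L2, excA441Li, deltaA441L2, deltaA441Li]

/-- the two seats' exceptional sets coincide: engine A's pair of charts fails exactly where the engine-B seat's three charts fail. -/
theorem excA441_iff_excB441 {z lam : K} (hz : z ^ 4 = -1) :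
    (excA441L2 z lam = 0 ∧ excA441Li z lam = 0) ↔ (exc441c1 z lam = 0 ∧ exc441c2 z lam = 0 ∧ exc441c3 z lam = 0) := by
  rw [excA441_eq hz, exceptional_set_eq hz]

/-! ## (4) The kernel theorem e ≥ 2 seen in the data: the leading u-linear layer of chart L2 has rank 1 -/

/-- chart L2, s-order 1, u-linear layer: [s¹u₁]c_{x4x5} = −(3/2)(z+z³)λ/(λ−ι), [s¹u₃]c_{x4x5} = (z+z³)λ(λ−1)/(λ−ι)², [s¹u₁]c_{x4²} = 3λ/(λ−ι), [s¹u₃]c_{x4²} = (2λ−2λ²)/(λ−ι)²;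
their 2×2 minor vanishes identically (numerator identity after clearing (λ−ι)³), as rank HF₂ ≤ 1 ⇐ e ≥ 2 requires. -/
theorem hf2_leading_minor_L2 (z lam : K) :
    (-(3 / 2) * (z + z ^ 3) * lam) * (2 * lam - 2 * lam ^ 2) - ((z + z ^ 3) * lam * (lam - 1)) * (3 * lam) = 0 := by
  ring

/-! ## (5) Supplement (lead gen 19, second item; record `ATONE-A441-g19.md`): engine A on the engine-B seat's THIRD chart λ* = 1 (free Λ-columns #1, #3, #7) — the chart VALID AT λ = 1

Kit j134147 (64 integer λ): Δ_A(L1) = −4·λ²(λ − ι)⁴ = 4 × the other seat's Δ₃; the 58 non-zero lowest-terms functions of this chart are again EQUAL to the engine-B seat's kernel-A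
functions (58/58; kernel B: (1/128)·(−1)^{|α|}, 58/58), and AT λ = 1 — where this chart is valid, Δ_A(1) = 16 — ALL 58 vanish, each with a SIMPLE zero (numerator = (λ − 1)¹ × a
polynomial non-vanishing at 1); at λ₀ ∈ {2, 3, −1, 1/2, −2} none vanishes.  This is the engine-A form of the other seat's observation 'the whole computed germ vanishes at λ = 1'
(`SymbolicCharts441` module docstring (4)); only the chart polynomial and one representative numerator are transcribed here. -/

/-- Δ_A of chart L1 (pivot rows x1², x1x3, x1x5, x1x4, x3², x3x5, x3x4, x5²; pivot Λ-columns 0,2,4,5,6,8,9,10). -/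
def deltaA441L1 (z lam : K) : K := -4 * lam ^ 2 * (lam - z ^ 2) ^ 4

omit [CharZero K] in
/-- Δ_A(L1) = 4·Δ₃ of the engine-B seat (same pivot block). -/
theorem deltaA441L1_eq (z lam : K) : deltaA441L1 z lam = 4 * delta441c3 z lam := by
  unfold deltaA441L1 delta441c3; ring

omit [CharZero K] in
/-- the value of Δ_A(L1) at λ = 1 is 16 (as evaluated by `symgermA.py atval`): (1 − ι)⁴ = −4. -/
theorem deltaA441L1_at_one (z : K) (hz : z ^ 4 = -1) : deltaA441L1 z 1 = 16 := by
  unfold deltaA441L1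
  linear_combination (-4 * z ^ 4 + 16 * z ^ 2 - 20) * hz

/-- engine A's chart L1 is VALID at λ = 1 (the point where charts L2 and Li both fail). -/
theorem chartL1_valid_at_one (z : K) (hz : z ^ 4 = -1) : deltaA441L1 z 1 ≠ 0 := by
  rw [deltaA441L1_at_one z hz]; norm_num

/-- engine A's chart L1 fails exactly at λ ∈ {0, ι}. -/
theorem deltaA441L1_eq_zero_iff {z lam : K} : deltaA441L1 z lam = 0 ↔ (lam = 0 ∨ lam = z ^ 2) := by
  unfold deltaA441L1
  constructor
  · intro h
    rcases mul_eq_zero.mp h with h | h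
    · rcases mul_eq_zero.mp h with h | h
      · norm_num at h
      · exact Or.inl (pow_eq_zero_iff (by norm_num) |>.mp h)
    · exact Or.inr (sub_eq_zero.mp (pow_eq_zero_iff (by norm_num) |>.mp h))
  · rintro (rfl | rfl) <;> simp

/-- a representative of the 58 numerators of chart L1: [s⁰u₁²u₃] c_{x0²} = 3ι·λ³(λ − 1) / (λ − ι)⁴ — the factor (λ − 1) is simple. -/
def numL1_x0sq_u1sq_u3 (z lam : K) : K := 3 * z ^ 2 * lam ^ 3 * (lam - 1)

omit [CharZero K] in
/-- it vanishes at λ = 1 (as do all 58). -/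
theorem numL1_x0sq_u1sq_u3_at_one (z : K) : numL1_x0sq_u1sq_u3 z 1 = 0 := by
  simp [numL1_x0sq_u1sq_u3]

/-- … and it does not vanish at a valid generic point, e.g. λ = 2 (value 24ι). -/
theorem numL1_x0sq_u1sq_u3_at_two (z : K) (hz : z ^ 4 = -1) : numL1_x0sq_u1sq_u3 z 2 ≠ 0 := by
  unfold numL1_x0sq_u1sq_u3
  have := z_ne_zero hz
  norm_num [this]

end Summit.HodgeConjecture.HodgeConjecture.HodgeLocus.Census.SymbolicChartsA441
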